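import Mathlib
import HarnessLib
import Literature.MathematicalPhysics.QuantumFieldTheory.ConstructiveQFTWave0
import Summits.Ventures.LatticeQCDFlow.Scaling.TunnellingLaws
import Summits.Ventures.LatticeQCDFlow.Scaling.FluxSectorCollar
import Summits.Ventures.LatticeQCDFlow.Scaling.SectorConfinement

/-!
# LatticeQCDFlow / Scaling — the METRIC small-step tunnelling law (v3.0, (C2c-T) / conjecture C7(a))

HONEST FRAMING: exact (Metropolis-corrected) sampling algorithms for lattice gauge theory; figures
of merit are autocorrelation/cost numbers at stated couplings and volumes; no continuum-physics
claim.

THEORY-2.md §3.3 (C2c-T) / §4 C7.  `FluxSmallSteps.lean` / `FluxTunnelling.lean` prove the small-step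
law for the `U(1)` flux charge with the explicit separating set `planeCollar 4ρ`.  This file isolates
the group-independent METRIC form, which is what the `SU(N)` version (conjecture C7(a)) needs:

* GEOMETRY.  `X` a pseudo-metric space with LOCAL PATHS (hypothesis `hpath`, no definition
  introduced): any two points `x, y` are joined by a path, continuous on `[0,1]`, that stays within
  `dist x y` of `x` — every geodesic space, every product `E → Y` of such spaces in the sup metric
  (`exists_localPath_pi`), in particular every compact-group configuration space `G^E` with the
  linkwise geodesics; for `U(1)^E` it is the tree's `anglePath` (`exists_localPath_gaugeConfig_circle`).
* CHARGE.  `Q : X → ι` continuous off a DEFECT SET `D` with values in a discrete space, or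
  `Q : X → ℝ` continuous off `D` and INTEGER-valued (the tree's `topCharge`; Lüscher's geometric
  charge off the non-admissible set would be the `SU(N)` input, THEORY-2.md C7).
* SEPARATING LEMMA (`mem_cthickening_of_dist_le_of_ne`, `…_real`): `dist x y ≤ ρ ∧ Q x ≠ Q y ⇒
  x ∈ cthickening ρ D` — a `ρ`-small move that changes the charge starts `ρ`-close to the defect
  set (the local path from `x` to `y` would otherwise avoid `D`, and `Q` is constant on a
  preconnected subset of `Dᶜ`; integer-valued real charges by the intermediate value theorem,
  `apply_eq_of_isPreconnected_of_forall_exists_int`).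
* LAWS (from the engine `compProd_chargeChange_le_of_invariant` / `measure_chargeChange_le_nsteps`):
  for every s-finite `μ` and every `μ`-INVARIANT Markov kernel with a.s. `ρ`-small moves,
  `(μ ⊗ₘ κ){Q ≠ Q'} ≤ 2·μ(cthickening ρ D)` (`compProd_ne_le_two_mul_cthickening`, `…_real`), and
  `P{Q(Z_n) ≠ Q(Z_0)} ≤ n·2·m(cthickening ρ D)` for processes with marginals `m`
  (`measure_ne_le_nsteps_cthickening_real`).
* `U(1)` INSTANCE (hypotheses inhabited): `compProd_topCharge_ne_le_cthickening_collar` — the law for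
  the tree's `topCharge x₀ μ ν` with `D = collar μ ν 0` (an exactly anti-aligned `(μ,ν)`-plaquette),
  using the tree's `continuousOn_topCharge_compl_collar_zero`, `exists_int_eq_topCharge`, `anglePath`;
  coarser than `FluxTunnelling.compProd_topCharge_ne_le_of_dist_le` (whose set is the plane collar
  `planeCollar 4ρ`) and recorded only as the instance check.
What remains for `SU(N)` (C7(a)) is exactly two named inputs: local paths on `SU(N)` (then on
`SU(N)^E` by `exists_localPath_pi`) and Lüscher's sector theorem (an integer charge continuous off the
non-admissible set, [cite: Luscher1982Topology]) as a cite-tagged Literature fact.  No sorry, no new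
axioms, no `def`.
-/

noncomputable section

open MeasureTheory ProbabilityTheory Set Metric
open scoped ENNReal ProbabilityTheory

namespace Summit.Ventures.LatticeQCDFlow.Theory2.Tunnelling

/-! ## §1. Integer-valued continuous functions are constant on preconnected sets -/

/-- An integer-valued real function continuous on a preconnected set is constant there
(intermediate value theorem: a value `n + 1/2` is never taken). [folklore] -/
theorem apply_eq_of_isPreconnected_of_forall_exists_int {Y : Type*} [TopologicalSpace Y] {s : Set Y}
    (hs : IsPreconnected s) {f : Y → ℝ} (hf : ContinuousOn f s) (hint : ∀ z ∈ s, ∃ n : ℤ, f z = n)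
    {x y : Y} (hx : x ∈ s) (hy : y ∈ s) : f x = f y := by
  have key : ∀ a b, a ∈ s → b ∈ s → ¬ f a < f b := by
    intro a b ha hb hlt
    obtain ⟨na, hna⟩ := hint a ha
    obtain ⟨nb, hnb⟩ := hint b hb
    have hab : na < nb := by
      have h : (na : ℝ) < nb := by rw [← hna, ← hnb]; exact hlt
      exact_mod_cast h
    have hab' : ((na + 1 : ℤ) : ℝ) ≤ nb := Int.cast_le.mpr (by omega)
    push_cast at hab'
    have hv : ((na : ℝ) + 1 / 2) ∈ Icc (f a) (f b) := by
      rw [hna, hnb]; constructor <;> linarith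
    obtain ⟨c, hc, hfc⟩ := hs.intermediate_value ha hb hf hv
    obtain ⟨nc, hnc⟩ := hint c hc
    have h2 : ((2 * nc : ℤ) : ℝ) = ((2 * na + 1 : ℤ) : ℝ) := by
      push_cast; rw [← hnc, hfc]; ring
    have h3 : 2 * nc = 2 * na + 1 := by exact_mod_cast h2
    omega
  rcases lt_trichotomy (f x) (f y) with h | h | h
  · exact absurd h (key x y hx hy)
  · exact h
  · exact absurd h (key y x hy hx)

/-! ## §2. The metric separating lemma: a small move that changes the charge starts near the defect set -/

section Separating

variable {X : Type*} [PseudoMetricSpace X]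

/-- Along a LOCAL PATH from `x` to `y` (continuous on `[0,1]`, within `dist x y` of `x`), if `x` is
not `ρ`-close to `D` and `dist x y ≤ ρ`, the whole path avoids `D`: there is a preconnected set
through `x` and `y` inside `Dᶜ`. [folklore] -/
theorem exists_isPreconnected_subset_compl {D : Set X}
    (hpath : ∀ x y : X, ∃ γ : ℝ → X, ContinuousOn γ (Icc (0 : ℝ) 1) ∧ γ 0 = x ∧ γ 1 = y ∧
      ∀ t ∈ Icc (0 : ℝ) 1, dist (γ t) x ≤ dist x y)
    {x y : X} {ρ : ℝ} (hxy : dist x y ≤ ρ) (hx : x ∉ cthickening ρ D) :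
    ∃ s : Set X, IsPreconnected s ∧ x ∈ s ∧ y ∈ s ∧ s ⊆ Dᶜ := by
  obtain ⟨γ, hγc, hγ0, hγ1, hγd⟩ := hpath x y
  refine ⟨γ '' Icc (0 : ℝ) 1, isPreconnected_Icc.image γ hγc, ⟨0, left_mem_Icc.2 zero_le_one, hγ0⟩,
    ⟨1, right_mem_Icc.2 zero_le_one, hγ1⟩, ?_⟩
  rintro _ ⟨t, ht, rfl⟩ hD
  exact hx (mem_cthickening_of_dist_le x (γ t) ρ D hD
    (by rw [dist_comm]; exact (hγd t ht).trans hxy))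

/-- **Metric separating lemma (discrete charge).**  If `X` has local paths and `Q` is continuous
off `D` with values in a discrete space, a move of length `≤ ρ` that changes `Q` starts in the
closed `ρ`-thickening of `D`. [folklore] -/
theorem mem_cthickening_of_dist_le_of_ne {ι : Type*} [TopologicalSpace ι] [DiscreteTopology ι]
    {D : Set X} {Q : X → ι} (hQ : ContinuousOn Q Dᶜ)
    (hpath : ∀ x y : X, ∃ γ : ℝ → X, ContinuousOn γ (Icc (0 : ℝ) 1) ∧ γ 0 = x ∧ γ 1 = y ∧
      ∀ t ∈ Icc (0 : ℝ) 1, dist (γ t) x ≤ dist x y)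
    {x y : X} {ρ : ℝ} (hxy : dist x y ≤ ρ) (hne : Q x ≠ Q y) : x ∈ cthickening ρ D := by
  by_contra hx
  obtain ⟨s, hs, hxs, hys, hsD⟩ := exists_isPreconnected_subset_compl hpath hxy hx
  exact hne (hs.constant (hQ.mono hsD) hxs hys)

/-- **Metric separating lemma (integer-valued real charge).**  The same for `Q : X → ℝ` continuous
off `D` and integer-valued (e.g. the tree's `U(1)` flux charge `topCharge`). [folklore] -/
theorem mem_cthickening_of_dist_le_of_ne_real {D : Set X} {Q : X → ℝ} (hQ : ContinuousOn Q Dᶜ)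
    (hint : ∀ x, ∃ n : ℤ, Q x = n)
    (hpath : ∀ x y : X, ∃ γ : ℝ → X, ContinuousOn γ (Icc (0 : ℝ) 1) ∧ γ 0 = x ∧ γ 1 = y ∧
      ∀ t ∈ Icc (0 : ℝ) 1, dist (γ t) x ≤ dist x y)
    {x y : X} {ρ : ℝ} (hxy : dist x y ≤ ρ) (hne : Q x ≠ Q y) : x ∈ cthickening ρ D := by
  by_contra hx
  obtain ⟨s, hs, hxs, hys, hsD⟩ := exists_isPreconnected_subset_compl hpath hxy hx
  exact hne (apply_eq_of_isPreconnected_of_forall_exists_int hs (hQ.mono hsD)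
    (fun z _ => hint z) hxs hys)

/-- Local paths pass to finite products in the sup metric (configuration spaces `E → G` from the
linkwise geodesics of `G`). [folklore] -/
theorem exists_localPath_pi {E : Type*} [Fintype E] {Y : Type*} [PseudoMetricSpace Y]
    (h : ∀ a b : Y, ∃ γ : ℝ → Y, ContinuousOn γ (Icc (0 : ℝ) 1) ∧ γ 0 = a ∧ γ 1 = b ∧
      ∀ t ∈ Icc (0 : ℝ) 1, dist (γ t) a ≤ dist a b)
    (x y : E → Y) : ∃ γ : ℝ → (E → Y), ContinuousOn γ (Icc (0 : ℝ) 1) ∧ γ 0 = x ∧ γ 1 = y ∧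
      ∀ t ∈ Icc (0 : ℝ) 1, dist (γ t) x ≤ dist x y := by
  choose γ hγc hγ0 hγ1 hγd using h
  refine ⟨fun t e => γ (x e) (y e) t, ?_, ?_, ?_, ?_⟩
  · exact continuousOn_pi.2 fun e => hγc (x e) (y e)
  · funext e; exact hγ0 _ _
  · funext e; exact hγ1 _ _
  · intro t ht
    refine (dist_pi_le_iff dist_nonneg).2 fun e => ?_
    exact (hγd (x e) (y e) t ht).trans (dist_le_pi_dist x y e)

end Separating

/-! ## §3. The metric small-step tunnelling laws -/

section Laws

variable {X : Type*} [PseudoMetricSpace X] [MeasurableSpace X]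

/-- **Metric small-step tunnelling law (discrete charge).**  Local paths, `Q` continuous off `D`
into a discrete space, `κ` a `μ`-invariant Markov kernel whose moves have length `≤ ρ` a.s.:
`(μ ⊗ₘ κ){Q ≠ Q'} ≤ 2·μ(cthickening ρ D)`. [folklore] -/
theorem compProd_ne_le_two_mul_cthickening {ι : Type*} [TopologicalSpace ι] [DiscreteTopology ι]
    {D : Set X} {Q : X → ι} (hQ : ContinuousOn Q Dᶜ)
    (hpath : ∀ x y : X, ∃ γ : ℝ → X, ContinuousOn γ (Icc (0 : ℝ) 1) ∧ γ 0 = x ∧ γ 1 = y ∧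
      ∀ t ∈ Icc (0 : ℝ) 1, dist (γ t) x ≤ dist x y)
    (μ : Measure X) [SFinite μ] (κ : Kernel X X) [IsMarkovKernel κ] (hinv : κ.Invariant μ) {ρ : ℝ}
    (hstep : ∀ᵐ p ∂(μ ⊗ₘ κ), dist p.1 p.2 ≤ ρ) :
    (μ ⊗ₘ κ) {p | Q p.1 ≠ Q p.2} ≤ 2 * μ (cthickening ρ D) :=
  compProd_chargeChange_le_of_invariant (R := fun x y => dist x y ≤ ρ)
    (fun _ _ hxy hne => Or.inl (mem_cthickening_of_dist_le_of_ne hQ hpath hxy hne)) μ κ hinv hstep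

/-- **Metric small-step tunnelling law (integer-valued real charge).** [folklore] -/
theorem compProd_ne_le_two_mul_cthickening_real {D : Set X} {Q : X → ℝ} (hQ : ContinuousOn Q Dᶜ)
    (hint : ∀ x, ∃ n : ℤ, Q x = n)
    (hpath : ∀ x y : X, ∃ γ : ℝ → X, ContinuousOn γ (Icc (0 : ℝ) 1) ∧ γ 0 = x ∧ γ 1 = y ∧
      ∀ t ∈ Icc (0 : ℝ) 1, dist (γ t) x ≤ dist x y)
    (μ : Measure X) [SFinite μ] (κ : Kernel X X) [IsMarkovKernel κ] (hinv : κ.Invariant μ) {ρ : ℝ}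
    (hstep : ∀ᵐ p ∂(μ ⊗ₘ κ), dist p.1 p.2 ≤ ρ) :
    (μ ⊗ₘ κ) {p | Q p.1 ≠ Q p.2} ≤ 2 * μ (cthickening ρ D) :=
  compProd_chargeChange_le_of_invariant (R := fun x y => dist x y ≤ ρ)
    (fun _ _ hxy hne => Or.inl (mem_cthickening_of_dist_le_of_ne_real hQ hint hpath hxy hne))
    μ κ hinv hstep

/-- **With an exceptional set** (no a.s. hypothesis on the step length; Gaussian-momentum moves):
`(μ ⊗ₘ κ){Q ≠ Q'} ≤ 2·μ(cthickening ρ D) + (μ ⊗ₘ κ){dist > ρ}`. [folklore] -/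
theorem compProd_ne_le_two_mul_cthickening_add_real {D : Set X} {Q : X → ℝ} (hQ : ContinuousOn Q Dᶜ)
    (hint : ∀ x, ∃ n : ℤ, Q x = n)
    (hpath : ∀ x y : X, ∃ γ : ℝ → X, ContinuousOn γ (Icc (0 : ℝ) 1) ∧ γ 0 = x ∧ γ 1 = y ∧
      ∀ t ∈ Icc (0 : ℝ) 1, dist (γ t) x ≤ dist x y)
    (μ : Measure X) [SFinite μ] (κ : Kernel X X) [IsMarkovKernel κ] (hinv : κ.Invariant μ) (ρ : ℝ) :
    (μ ⊗ₘ κ) {p | Q p.1 ≠ Q p.2} ≤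
      2 * μ (cthickening ρ D) + (μ ⊗ₘ κ) {p | ¬ dist p.1 p.2 ≤ ρ} :=
  compProd_chargeChange_le_add_of_invariant (R := fun x y => dist x y ≤ ρ)
    (fun _ _ hxy hne => Or.inl (mem_cthickening_of_dist_le_of_ne_real hQ hint hpath hxy hne))
    μ κ hinv

/-- **`n`-step metric law (integer-valued real charge).**  Any process with all marginals `m` and
a.s. `ρ`-small consecutive steps keeps its charge for `n` steps except with probability
`≤ n·2·m(cthickening ρ D)`. [folklore] -/
theorem measure_ne_le_nsteps_cthickening_real {D : Set X} {Q : X → ℝ} (hQ : ContinuousOn Q Dᶜ)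
    (hint : ∀ x, ∃ n : ℤ, Q x = n)
    (hpath : ∀ x y : X, ∃ γ : ℝ → X, ContinuousOn γ (Icc (0 : ℝ) 1) ∧ γ 0 = x ∧ γ 1 = y ∧
      ∀ t ∈ Icc (0 : ℝ) 1, dist (γ t) x ≤ dist x y)
    {Ω : Type*} [MeasurableSpace Ω] (P : Measure Ω) (Z : ℕ → Ω → X) (hZ : ∀ k, Measurable (Z k))
    (m : Measure X) (hmarg : ∀ k, P.map (Z k) = m) {ρ : ℝ}
    (hstep : ∀ k, ∀ᵐ ω ∂P, dist (Z k ω) (Z (k + 1) ω) ≤ ρ) (n : ℕ) :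
    P {ω | Q (Z n ω) ≠ Q (Z 0 ω)} ≤ n * (2 * m (cthickening ρ D)) := by
  refine measure_chargeChange_le_nsteps (R := fun _ x y => dist x y ≤ ρ)
    (B := fun _ => cthickening ρ D)
    (fun _ _ _ hxy hne => Or.inl (mem_cthickening_of_dist_le_of_ne_real hQ hint hpath hxy hne))
    P Z hstep (fun k => ?_) n
  have h1 : ∀ j, P (Z j ⁻¹' cthickening ρ D) ≤ m (cthickening ρ D) := fun j => by
    rw [← hmarg j]; exact Measure.le_map_apply (hZ j).aemeasurable _
  calc P (Z k ⁻¹' cthickening ρ D) + P (Z (k + 1) ⁻¹' cthickening ρ D)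
      ≤ m (cthickening ρ D) + m (cthickening ρ D) := add_le_add (h1 k) (h1 (k + 1))
    _ = 2 * m (cthickening ρ D) := (two_mul _).symm

end Laws

/-! ## §4. The `U(1)` instance: the hypotheses are inhabited (tree: `anglePath`, `topCharge`, `collar`) -/

section Circle

open Literature.MathematicalPhysics.QuantumFieldTheory
open Summit.Ventures.LatticeQCDFlow.Theory2.Lattice.Flux

variable {d L : ℕ} [NeZero L]

/-- `U(1)^E` has local paths: the tree's linkwise geodesic `anglePath`. [folklore] -/
theorem exists_localPath_gaugeConfig_circle (U U' : GaugeConfig d L Circle) :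
    ∃ γ : ℝ → GaugeConfig d L Circle, ContinuousOn γ (Icc (0 : ℝ) 1) ∧ γ 0 = U ∧ γ 1 = U' ∧
      ∀ t ∈ Icc (0 : ℝ) 1, dist (γ t) U ≤ dist U U' :=
  ⟨anglePath U U', (continuous_anglePath U U').continuousOn, anglePath_zero U U', anglePath_one U U',
    fun _ ht => (dist_anglePath_le U U' ht).trans_eq (dist_comm U' U)⟩

/-- **Metric small-step law for the `U(1)` flux charge** with the defect set
`collar μ ν 0 = {∃ x, U_{μν}(x) = −1}`: for every s-finite `m` and `m`-invariant Markov kernel with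
a.s. `ρ`-small moves, `(m ⊗ₘ κ){Q ≠ Q'} ≤ 2·m(cthickening ρ (collar μ ν 0))` — the instance check of
§3 (the sharper plane-collar law is `FluxTunnelling.compProd_topCharge_ne_le_of_dist_le`). [folklore] -/
theorem compProd_topCharge_ne_le_cthickening_collar (x₀ : Site d L) (μ ν : Fin d)
    (m : Measure (GaugeConfig d L Circle)) [SFinite m]
    (κ : Kernel (GaugeConfig d L Circle) (GaugeConfig d L Circle)) [IsMarkovKernel κ]
    (hinv : κ.Invariant m) {ρ : ℝ} (hstep : ∀ᵐ q ∂(m ⊗ₘ κ), dist q.1 q.2 ≤ ρ) :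
    (m ⊗ₘ κ) {q | topCharge x₀ μ ν q.1 ≠ topCharge x₀ μ ν q.2} ≤
      2 * m (cthickening ρ (collar (L := L) μ ν 0)) :=
  compProd_ne_le_two_mul_cthickening_real (continuousOn_topCharge_compl_collar_zero x₀ μ ν)
    (fun U => exists_int_eq_topCharge x₀ μ ν U) exists_localPath_gaugeConfig_circle m κ hinv hstep

end Circle

end Summit.Ventures.LatticeQCDFlow.Theory2.Tunnelling
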